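import Summits.ResolutionOfSingularities.ResolutionOfSingularities.Theses.WildPurity

/-!
# `WildSymbol` (stmt-ResolutionOfSingularities-17133) — negative lemmas I: where a witness cannot live

Support (negative) lemmas for crux #2 of route `ResolutionOfSingularities/WildPurity`
(`Summit.ResolutionOfSingularities.ResolutionOfSingularities.Theses.WildPurity.WildSymbol`: there are a
prime `p`, a perfect field `k` of characteristic `p`, a finitely generated field `K/k`, a valuation ring
`O ⊇ k` of `K`, an affine model `R ⊆ O` of `K` and a class `α` of Kato's symbolic `H³_p(K) = G ⧸ N` that is
`W`-integral at every DIVISORIAL valuation ring `W ⊇ R` of `K/k` centred inside the centre of `O`, yet is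
not `O`-integral), filed by the standing disprover (cdisprove cycle 1; work file
`Cruxes/WildSymbol/Disproof.lean` carries the full analysis, the named restatement of the crux and the
transcription audit of the symbol group). This file declares NO definition (every variant statement is
written out inline, the symbol group and `Unr` by the route's own `let`s) and NO declaration concludes the
route decl `WildSymbol` positively.

* `wildSymbol_false_without_divisorial` — LOAD-BEARING: with the restriction "W is a DVR essentially of
  finite type over k" deleted from the test class (so `α` must be integral at EVERY valuation ring
  `W ⊇ R`, `k ⊆ W`, centred inside the centre of `O`) the statement is FALSE: `W := O` is tested.
  Every construction of a witness must place `O` OUTSIDE the divisorial class.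
* `not_wildSymbol_with_divisorial_O` — the special case "`O` itself divisorial" is impossible (same
  instance): witness places are non-divisorial.
* `wildSymbol_unr_top` / `not_wildSymbol_at_top` — at the trivial valuation ring `⊤ = K` every class is
  integral (symbols generate `G ⧸ N`), so no witness has `O = ⊤`; equivalently the centre `𝔪_O ∩ R` of a
  witness is non-zero.
* `wildSymbol_valuationSubring_eq_top_of_isAlgebraic` / `not_wildSymbol_of_isAlgebraic` — the degenerate
  instance trdeg `K/k = 0`: a valuation ring of `K` containing `k` contains every `k`-integral element, so
  for `K/k` algebraic `O = ⊤` and there is no witness. (The unconditional transcendence-degree bound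
  provable in the tree today is `≥ 1`; the route's "≥ 4" rests on CossartPiltant2019 + PurityTransfer.)

## Sources
* K. Kato, *Galois cohomology of complete discrete valuation fields*, LNM 967 (1982), §1
  (doi:10.1007/bfb0061904) — the symbolic presentation of `H^q_p`.
* S. Bloch, K. Kato, *p-adic étale cohomology*, Publ. Math. IHÉS 63 (1986), Lemma 4.2
  (doi:10.1007/bf02831624).
-/

noncomputable section

set_option linter.dupNamespace false -- mandated namespace of this single-conjunct summit

namespace Summit.ResolutionOfSingularities.ResolutionOfSingularities.Theorems.WildSymbol.Negative

/-- **Symbols generate**: if the subring `T` is all of `K`, the subgroup of `G ⧸ N` generated by the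
`T`-integral symbols is everything (the route's `Unr T = ⊤`). [folklore] -/
theorem wildSymbol_unr_eq_top_of_forall_mem (p : ℕ) (K : Type) [Field K] (T : Subring K)
    (hT : ∀ x : K, x ∈ T) :
    (let G := FreeAbelianGroup (K × Kˣ × Kˣ); let N : AddSubgroup G := AddSubgroup.closure { x | (∃ (a a' : K) (b c : Kˣ), x = .of (a + a', b, c) - .of (a, b, c) - .of (a', b, c)) ∨ (∃ (a : K) (b b' c : Kˣ), x = .of (a, b * b', c) - .of (a, b, c) - .of (a, b', c)) ∨ (∃ (a : K) (b c c' : Kˣ), x = .of (a, b, c * c') - .of (a, b, c) - .of (a, b, c')) ∨ (∃ (a : K) (b : Kˣ), x = .of (a, b, b)) ∨ (∃ (b c : Kˣ), x = .of ((b : K), b, c)) ∨ (∃ (b c : Kˣ), x = .of ((c : K), b, c)) ∨ (∃ (a : K) (b c : Kˣ), x = .of (a ^ p - a, b, c)) }; let Unr : Subring K → AddSubgroup (G ⧸ N) := fun T => AddSubgroup.closure { y | ∃ (a : K) (b c : Kˣ), a ∈ T ∧ (b : K) ∈ T ∧ ((b⁻¹ : Kˣ) : K) ∈ T ∧ (c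 : K) ∈ T ∧ ((c⁻¹ : Kˣ) : K) ∈ T ∧ y = ((FreeAbelianGroup.of (a, b, c) : G) : G ⧸ N) };
    Unr T = ⊤) := by
  intro G N Unr
  have key : ∀ α : G ⧸ N, α ∈ Unr T := by
    intro α
    induction α using QuotientAddGroup.induction_on with
    | H g =>
      induction g using FreeAbelianGroup.induction_on with
      | zero => rw [QuotientAddGroup.mk_zero]; exact (Unr T).zero_mem
      | of x =>
        obtain ⟨a, b, c⟩ := x
        exact AddSubgroup.subset_closure ⟨a, b, c, hT _, hT _, hT _, hT _, hT _, rfl⟩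
      | neg x hx => rw [QuotientAddGroup.mk_neg]; exact (Unr T).neg_mem hx
      | add x y hx hy => rw [QuotientAddGroup.mk_add]; exact (Unr T).add_mem hx hy
  exact eq_top_iff.mpr fun α _ => key α

/-- **`Unr(K) = H³_p(K)`** for the trivial valuation ring `⊤ : ValuationSubring K`. [folklore] -/
theorem wildSymbol_unr_top (p : ℕ) (K : Type) [Field K] :
    (let G := FreeAbelianGroup (K × Kˣ × Kˣ); let N : AddSubgroup G := AddSubgroup.closure { x | (∃ (a a' : K) (b c : Kˣ), x = .of (a + a', b, c) - .of (a, b, c) - .of (a', b, c)) ∨ (∃ (a : K) (b b' c : Kˣ), x = .of (a, b * b', c) - .of (a, b, c) - .of (a, b', c)) ∨ (∃ (a : K) (b c c' : Kˣ), x = .of (a, b, c * c') - .of (a, b, c) - .of (a, b, c')) ∨ (∃ (a : K) (b : Kˣ), x = .of (a, b, b)) ∨ (∃ (b c : Kˣ), x = .of ((b : K), b, c)) ∨ (∃ (b c : Kˣ), x = .of ((c : K), b, c)) ∨ (∃ (a : K) (b c : Kˣ), x = .of (a ^ p - a, b, c)) }; let Unr : Subring K → AddSubgroup (G ⧸ N)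 := fun T => AddSubgroup.closure { y | ∃ (a : K) (b c : Kˣ), a ∈ T ∧ (b : K) ∈ T ∧ ((b⁻¹ : Kˣ) : K) ∈ T ∧ (c : K) ∈ T ∧ ((c⁻¹ : Kˣ) : K) ∈ T ∧ y = ((FreeAbelianGroup.of (a, b, c) : G) : G ⧸ N) };
    Unr (⊤ : ValuationSubring K).toSubring = ⊤) :=
  wildSymbol_unr_eq_top_of_forall_mem p K _ fun x => ValuationSubring.mem_top x

/-- **No witness at the trivial valuation** (the crux with `O := ⊤` is FALSE): everything is
`⊤`-integral. Hence the centre `𝔪_O ∩ R` of any witness is a NON-ZERO prime of `R`. [folklore] -/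
theorem not_wildSymbol_at_top :
    ¬ ∃ p : ℕ, p.Prime ∧ ∃ (k K : Type) (_ : Field k) (_ : CharP k p) (_ : PerfectField k) (_ : Field K) (_ : Algebra k K), (⊤ : IntermediateField k K).FG ∧ ∃ R : Subalgebra k K, R.FG ∧ IsFractionRing R K ∧ (let G := FreeAbelianGroup (K × Kˣ × Kˣ); let N : AddSubgroup G := AddSubgroup.closure { x | (∃ (a a' : K) (b c : Kˣ), x = .of (a + a', b, c) - .of (a, b, c) - .of (a', b, c)) ∨ (∃ (a : K) (b b' c : Kˣ), x = .of (a, b * b', c) - .of (a, b, c) - .of (a, b', c)) ∨ (∃ (a : K) (b c c' : Kˣ), x = .of (a, b, c * c') - .of (a, b, c) - .of (a, b, c')) ∨ (∃ (a : K) (b : Kˣ), x = .of (a, b, b)) ∨ (∃ (b c : Kˣ), x = .of ((b : K), b, c)) ∨ (∃ (b c : Kˣ), x = .of ((c : K), b, c)) ∨ (∃ (a : K) (b c : Kˣ), x = .of (a ^ p - a, b, c)) }; let Unr : Subring K → AddSubgroup (G ⧸ N) := fun T => AddSubgroup.closure { y | ∃ (a : K) (b c : Kˣ), a ∈ T ∧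 (b : K) ∈ T ∧ ((b⁻¹ : Kˣ) : K) ∈ T ∧ (c : K) ∈ T ∧ ((c⁻¹ : Kˣ) : K) ∈ T ∧ y = ((FreeAbelianGroup.of (a, b, c) : G) : G ⧸ N) }; ∃ α : G ⧸ N, (∀ W : ValuationSubring K, (∀ c : k, algebraMap k K c ∈ W) → IsDiscreteValuationRing W → (∃ B : Subalgebra k K, B.FG ∧ B.toSubring ≤ W.toSubring ∧ ∀ x : K, x ∈ W → ∃ b s : K, b ∈ B ∧ s ∈ B ∧ s ∉ W.nonunits ∧ x * s = b) → R.toSubring ≤ W.toSubring → (∀ x : K, x ∈ R → x ∈ W.nonunits → x ∈ (⊤ : ValuationSubring K).nonunits) → α ∈ Unr W.toSubring) ∧ α ∉ Unr (⊤ : ValuationSubring K).toSubring) := by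
  rintro ⟨p, -, k, K, _, _, _, _, _, -, R, -, -, α, -, hα⟩
  exact hα (by rw [wildSymbol_unr_top p K]; trivial)

/-- **LOAD-BEARING: the divisorial restriction of the test class.** The crux with "W is a DVR
essentially of finite type over k" DELETED (everything else verbatim: `α` integral at every valuation
ring `W ⊇ R` containing `k` whose centre on `R` lies inside the centre of `O`, yet `α ∉ Unr O`) is FALSE:
`W := O` is such a ring. [folklore] -/
theorem wildSymbol_false_without_divisorial :
    ¬ ∃ p : ℕ, p.Prime ∧ ∃ (k K : Type) (_ : Field k) (_ : CharP k p) (_ : PerfectField k) (_ : Field K) (_ : Algebra k K), (⊤ : IntermediateField k K).FG ∧ ∃ O : ValuationSubring K, (∀ c : k, algebraMap k K c ∈ O) ∧ ∃ R : Subalgebra k K, R.FG ∧ R.toSubring ≤ O.toSubring ∧ IsFractionRing R K ∧ (let G := FreeAbelianGroup (K × Kˣ × Kˣ); let N : AddSubgroup G := AddSubgroup.closure { x | (∃ (a a' : K) (b c : Kˣ), x = .of (a + a', b, c) - .of (a, b, c) - .of (a', b, c)) ∨ (∃ (a : K) (b b' c : Kˣ), x = .of (a, b * b', c) - .of (a,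 b, c) - .of (a, b', c)) ∨ (∃ (a : K) (b c c' : Kˣ), x = .of (a, b, c * c') - .of (a, b, c) - .of (a, b, c')) ∨ (∃ (a : K) (b : Kˣ), x = .of (a, b, b)) ∨ (∃ (b c : Kˣ), x = .of ((b : K), b, c)) ∨ (∃ (b c : Kˣ), x = .of ((c : K), b, c)) ∨ (∃ (a : K) (b c : Kˣ), x = .of (a ^ p - a, b, c)) }; let Unr : Subring K → AddSubgroup (G ⧸ N) := fun T => AddSubgroup.closure { y | ∃ (a : K) (b c : Kˣ), a ∈ T ∧ (b : K) ∈ T ∧ ((b⁻¹ : Kˣ) : K) ∈ T ∧ (c : K) ∈ T ∧ ((c⁻¹ : Kˣ) : K) ∈ T ∧ y = ((FreeAbelianGroup.of (a, b, c) : G) : G ⧸ N) }; ∃ α : G ⧸ N, (∀ W : ValuationSubring K, (∀ c : k, algebraMap k K c ∈ W) → R.toSubring ≤ W.toSubring → (∀ x : K, x ∈ R → x ∈ W.nonunits → x ∈ O.nonunits) → α ∈ Unr W.toSubring) ∧ α ∉ Unr O.toSubring) := by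
  rintro ⟨p, -, k, K, _, _, _, _, _, -, O, hO, R, -, hRO, -, α, hall, hα⟩
  exact hα (hall O hO hRO fun x _ hx => hx)

/-- **No witness at a divisorial place.** The crux with the extra demand that `O` ITSELF be a DVR
essentially of finite type over `k` is FALSE: `O` is then one of the tested `W`. [folklore] -/
theorem not_wildSymbol_with_divisorial_O :
    ¬ ∃ p : ℕ, p.Prime ∧ ∃ (k K : Type) (_ : Field k) (_ : CharP k p) (_ : PerfectField k) (_ : Field K) (_ : Algebra k K), (⊤ : IntermediateField k K).FG ∧ ∃ O : ValuationSubring K, (∀ c : k, algebraMap k K c ∈ O) ∧ IsDiscreteValuationRing O ∧ (∃ B : Subalgebra k K, B.FG ∧ B.toSubring ≤ O.toSubring ∧ ∀ x : K, x ∈ O → ∃ b s : K, b ∈ B ∧ s ∈ B ∧ s ∉ O.nonunits ∧ x * s = b) ∧ ∃ R : Subalgebra k K, R.FG ∧ R.toSubring ≤ O.toSubring ∧ IsFractionRing R K ∧ (let G := FreeAbelianGroup (K × Kˣ × Kˣ); let N : AddSubgroup G := AddSubgroup.closure { x | (∃ (a a' : K) (b c : Kˣ), x = .of (a + a', b, c)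 - .of (a, b, c) - .of (a', b, c)) ∨ (∃ (a : K) (b b' c : Kˣ), x = .of (a, b * b', c) - .of (a, b, c) - .of (a, b', c)) ∨ (∃ (a : K) (b c c' : Kˣ), x = .of (a, b, c * c') - .of (a, b, c) - .of (a, b, c')) ∨ (∃ (a : K) (b : Kˣ), x = .of (a, b, b)) ∨ (∃ (b c : Kˣ), x = .of ((b : K), b, c)) ∨ (∃ (b c : Kˣ), x = .of ((c : K), b, c)) ∨ (∃ (a : K) (b c : Kˣ), x = .of (a ^ p - a, b, c)) }; let Unr : Subring K → AddSubgroup (G ⧸ N) := fun T => AddSubgroup.closure { y | ∃ (a : K) (b c : Kˣ), a ∈ T ∧ (b : K) ∈ T ∧ ((b⁻¹ : Kˣ) : K) ∈ T ∧ (c : K) ∈ T ∧ ((c⁻¹ : Kˣ) : K) ∈ T ∧ y = ((FreeAbelianGroup.of (a, b, c) : G) : G ⧸ N) }; ∃ α : G ⧸ N, (∀ W : ValuationSubring K, (∀ c : k, algebraMap k K c ∈ W) → IsDiscreteValuationRing W → (∃ B : Subalgebra k K, B.FG ∧ B.toSubring ≤ W.toSubring ∧ ∀ x : K, x ∈ W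 → ∃ b s : K, b ∈ B ∧ s ∈ B ∧ s ∉ W.nonunits ∧ x * s = b) → R.toSubring ≤ W.toSubring → (∀ x : K, x ∈ R → x ∈ W.nonunits → x ∈ O.nonunits) → α ∈ Unr W.toSubring) ∧ α ∉ Unr O.toSubring) := by
  rintro ⟨p, -, k, K, _, _, _, _, _, -, O, hO, hdvr, heft, R, -, hRO, -, α, hdiv, hα⟩
  exact hα (hdiv O hO hdvr heft hRO fun x _ hx => hx)

/-- A valuation subring of `K` containing the field `k` contains every `k`-integral element of `K`
(valuation rings are integrally closed). [folklore] -/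
theorem wildSymbol_mem_valuationSubring_of_isIntegral {k K : Type} [Field k] [Field K] [Algebra k K]
    (O : ValuationSubring K) (hO : ∀ c : k, algebraMap k K c ∈ O) {x : K} (hx : IsIntegral k x) :
    x ∈ O := by
  obtain ⟨f, hf, hfx⟩ := hx
  let φ : k →+* O := (algebraMap k K).codRestrict O.toSubring fun c => hO c
  have hφ : (algebraMap O K).comp φ = algebraMap k K := RingHom.ext fun _ => rfl
  have hint : IsIntegral O x := ⟨f.map φ, hf.map φ, by rw [Polynomial.eval₂_map, hφ, hfx]⟩
  have hv : O.valuation.Integers O :=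
    ⟨Subtype.val_injective, fun a => O.valuation_le_one a,
      fun r hr => ⟨⟨r, O.mem_of_valuation_le_one r hr⟩, rfl⟩⟩
  exact (O.valuation_le_one_iff x).mp (hv.isIntegral_iff_v_le_one.mp hint)

/-- **Degenerate instance trdeg `0`**: for `K/k` algebraic the only valuation ring of `K` containing `k`
is `⊤`. [folklore] -/
theorem wildSymbol_valuationSubring_eq_top_of_isAlgebraic {k K : Type} [Field k] [Field K]
    [Algebra k K] [Algebra.IsAlgebraic k K] (O : ValuationSubring K)
    (hO : ∀ c : k, algebraMap k K c ∈ O) : O = ⊤ := by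
  ext x
  simp only [ValuationSubring.mem_top, iff_true]
  exact wildSymbol_mem_valuationSubring_of_isIntegral O hO
    (Algebra.IsAlgebraic.isAlgebraic (R := k) x).isIntegral

/-- **No witness in transcendence degree `0`.** The crux with the extra hypothesis
`Algebra.IsAlgebraic k K` is FALSE (`O = ⊤`, then `Unr ⊤ = ⊤`). [folklore] -/
theorem not_wildSymbol_of_isAlgebraic :
    ¬ ∃ p : ℕ, p.Prime ∧ ∃ (k K : Type) (_ : Field k) (_ : CharP k p) (_ : PerfectField k) (_ : Field K) (_ : Algebra k K), (⊤ : IntermediateField k K).FG ∧ Algebra.IsAlgebraic k K ∧ ∃ O : ValuationSubring K, (∀ c : k, algebraMap k K c ∈ O) ∧ ∃ R : Subalgebra k K, R.FG ∧ R.toSubring ≤ O.toSubring ∧ IsFractionRing R K ∧ (let G := FreeAbelianGroup (K × Kˣ × Kˣ); let N : AddSubgroup G := AddSubgroup.closure { x | (∃ (a a' : K) (b c : Kˣ), x = .of (a + a', b, c) - .of (a, b, c) - .of (a', b, c)) ∨ (∃ (a : K) (b b' c : Kˣ), x = .of (a, b * b', c) - .of (a, b, c) - .of (a, b', c)) ∨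 (∃ (a : K) (b c c' : Kˣ), x = .of (a, b, c * c') - .of (a, b, c) - .of (a, b, c')) ∨ (∃ (a : K) (b : Kˣ), x = .of (a, b, b)) ∨ (∃ (b c : Kˣ), x = .of ((b : K), b, c)) ∨ (∃ (b c : Kˣ), x = .of ((c : K), b, c)) ∨ (∃ (a : K) (b c : Kˣ), x = .of (a ^ p - a, b, c)) }; let Unr : Subring K → AddSubgroup (G ⧸ N) := fun T => AddSubgroup.closure { y | ∃ (a : K) (b c : Kˣ), a ∈ T ∧ (b : K) ∈ T ∧ ((b⁻¹ : Kˣ) : K) ∈ T ∧ (c : K) ∈ T ∧ ((c⁻¹ : Kˣ) : K) ∈ T ∧ y = ((FreeAbelianGroup.of (a, b, c) : G) : G ⧸ N) }; ∃ α : G ⧸ N, (∀ W : ValuationSubring K, (∀ c : k, algebraMap k K c ∈ W) → IsDiscreteValuationRing W → (∃ B : Subalgebra k K, B.FG ∧ B.toSubring ≤ W.toSubring ∧ ∀ x : K, x ∈ W → ∃ b s : K, b ∈ B ∧ s ∈ B ∧ s ∉ W.nonunits ∧ x * s = b) → R.toSubring ≤ W.toSubring → (∀ x : K, x ∈ R →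 x ∈ W.nonunits → x ∈ O.nonunits) → α ∈ Unr W.toSubring) ∧ α ∉ Unr O.toSubring) := by
  rintro ⟨p, -, k, K, _, _, _, _, _, -, halg, O, hO, R, -, -, -, α, -, hα⟩
  obtain rfl : O = ⊤ := wildSymbol_valuationSubring_eq_top_of_isAlgebraic O hO
  exact hα (by rw [wildSymbol_unr_top p K]; trivial)

end Summit.ResolutionOfSingularities.ResolutionOfSingularities.Theorems.WildSymbol.Negative

end
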